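import Mathlib
import Summits.Ventures.FusionMHD.Models.CerfonFreidbergIterLikeQ25Defs
import HarnessLib

/-!
# Ventures/FusionMHD — Models/CerfonFreidbergIterLikeQ25Panels9.lean: KERNEL CHECK of panels 30, 31 (of 32) of the
# certified safety factor `q(ψ_N = 1/4)/F` of THE Cerfon–Freidberg ITER-like instance (sibling of `…IterLikeQHalfPanels*.lean`)

HONEST FRAMING (LADDER-GRIDFUSION three columns; CF rung, F2 item R2, q-profile sample).  One `decide +kernel` (≈ 86 s on the farm): for
each panel `j` listed, the per-panel obligation `CFIterLike.Q25.PanelCert.ok` (`Models/CerfonFreidbergIterLikeQ25Defs.lean`) — the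
Taylor-model run of `CFIterLike.Q25.progG` over the ITER-like parameter box is ACCEPTED (every `log`/`sin`/`cos` composition and the `inv`
certificate), and the kernel's panel-integral enclosure of the polar `(6.35)` integrand along the approximant, the range of the flux residual
`U(ray m) − 3U_a/4`, the range of the approximant `m` and the range of the radial derivative `D_r(θ, m)` lie inside the integers claimed in
`panelCert9` (values read off a compiled `#eval` of the same functions, slack one unit of `2⁻⁶⁰`; probe `QProbeIF*.lean`, generator
`pub/gridfusion/models/gen-model-5/g8/gen90/mkdefsN.py`).  What these Booleans MEAN (real-number statements, uniformly over the parameter box ∋ THE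
ITER-like instance) is proved once in `Models/CerfonFreidbergIterLikeQ25Sound.lean`.  MODELLED: analytic Cerfon–Freidberg family; `q` of a
MODEL surface — nothing about a device or stability.  No `native_decide`.  Typer/prover: gridfusion-model-5 (g8), 2026-08-27.
Citations: Freidberg 2014 §6.3.5 (6.35) [Freidberg2014]; Mahboubi–Melquiond–Sibut-Pinote 2016 §3.2 Lemma 3 [MahboubiMelquiondSibutpinote2016].
-/

namespace Summit.Ventures.FusionMHD.Models.CFIterLike.Q25

/-- The certificate data of panels 30, 31 (`ψ_N = 1/4`): `inv` candidate (degree-12 fit of `(X·D_r)⁻¹` in the panel variable, scaled by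
`2⁶⁰`), Taylor degree, `inv` widening `2^elog2`, and the claimed integral / residual / `m`-range / `D_r`-range integers (× `2⁶⁰`). [instance data] -/
def panelCert9 : List PanelCert := [
  { j := 30, cand := [12857003732033280000, -4346082509349019648, 46951222301068713984, -12377093725641529344, 58457806174039638016, 104346043608721883136, -510510560743938195456, 1360541333445224693760, -6066039498328199135232, -62709378215228934717440, 6438797859392316470460416, 139701633690602008177803264, -10480329082798924090996424704],
    deg := 12, elog2 := 37, plo := 210450345882155094, phi := 210450351212759857, eta := 158696247, mlo := 190987572738920722, mhi := 193236391946532130,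
    dlo := 116621180988268194, dhi := 118182454196039520 },
  { j := 31, cand := [12766720156917168128, -1440342132531887104, 46158667088670105600, -4324631156166007296, 68441043635712589824, 29190266687118352384, -325010054223205236736, 343568963062797172736, -8517804454300362997760, 192847826137102631829504, 20039542670934021645533184, -250315338047844994359754752, -28629015642893467925654536192],
    deg := 12, elog2 := 37, plo := 207579581580874812, phi := 207579587046065235, eta := 194521219, mlo := 190355734166733972, mhi := 191312385709736807,
    dlo := 117961046795629055, dhi := 118636258722751580 }]

/-- **KERNEL CHECK** of panels 30, 31 of the ITER-like surface `ψ_N = 1/4`. -/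
theorem panelCert9_ok : CFIterLike.Q25.panelCert9.all PanelCert.ok = true := by
  decide +kernel

/-- This file carries the certificates of two panels (30, 31). -/
theorem panelCert9_length : CFIterLike.Q25.panelCert9.length = 2 := by decide

end Summit.Ventures.FusionMHD.Models.CFIterLike.Q25
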